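import Summits.NavierStokesRegularity.NavierStokesRegularity.Theorems.ScenarioCensusRowF1NeedleTopRows
import HarnessLib

/-!
# LINE 37 «needle-top» port, part 3/3: §6 RADIALLY CALM SECTORS — one component on a cap of rays (`Row_F1sc`, `rowF1sc_holds`, `sectorLevel`, the SWIRL floor); §7 summary;
# census KEYS `Row_F1nd` / `Row_F1ne` / `Row_F1sc` + `_excluded`, floors HF / SWF, edges

Re-homed for the scenario census (typer seat ns-census-typer-1 g10; the cells F1nd / F1ne / F1sc and the floors HF / SWF are MEMBERS OF RECORD «DECIDED IN KERNEL IN FILES» of row F1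
(item 78: critic idea-crit-3 g9 PASS no price 11:16:43Z; ref PRE-CHECK ✓; lead label LBL78); this port makes them TREE-decided): VERBATIM PORT of ns-idea-3 LINE 37 «needle-top»,
`pub/ideators/ns-idea-3/lines/needle-top/line-needle-top.lean` sha16 a98a4df70fd31916 (1057 l., lean check rc 0, 0 sorry), split for the 400-line rule into
`ScenarioCensusRowF1NeedleTop` (§1–§3) → `…NeedleTopRows` (§4–§5) → `…NeedleTopSector` (§6–§7 + census KEYS).  Lean text VERBATIM in namespace
`…Theorems.ScenarioCensus.NeedleTop` (the line's `…Cruxes.ScenarioCensusRowF1.NeedleTopLine` re-homed); port edits: the frame restated VERBATIM by the line from LINES 34/35/36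
and «caged-top» (`topSet`, `HasTypeIConstant`, `snapLevel`, `exists_fast_at`, `CalmPocketsAt`, `Row_F1cs`, `HasPorousTopAt`, `IsSubcriticalLevel`, `HasPorousTop`, `Row_F1po`, order
lemmas) is taken BY NAME from the landed two-time-top / one-level-top / snapshot-top ports; the second proof terms `rowF1cs_holds` / `rowF1po_holds` are not re-declared
(routes `rowF1cs_of_rowF1nd rowF1nd_holds`, `rowF1po_of_rowF1nd rowF1nd_holds`); the line's NEW compactness / socket / zoom package WITH the locally-uniform clause
(`limitClass_compact`, `exists_level_of_limitKill`, `exists_snapshotZoom_package`) are kept verbatim (new statements); the bookkeeping lemma `tendstoLocallyUniformly_comp_of_tendsto` (a twin of a landed lemma in a route-cone module) is not re-declared, its 3-line proof is inlined at the one use site; `@[conjecture]` on the residual `NeedleCollapse`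
(≡ `ScenarioCensus.Row_F1`, OPEN); one-line docstrings added where missing (gate lint).  Statements untouched.

No census VALUE is moved here (row F1 stays OPEN-WITH-LINE; the members become TREE-decided by name); NS regularity is NOT proved; `Row_F1` is untouched (zero
movement, `needleCollapse_iff_rowF1`); no summit statement is proved by this file. Lemmas that restate already-landed tree declarations are taken BY NAME (gate lint `dedup.landed`): `topSet` = `TwoTimeTop.topSet`, `HasTypeIConstant` = `OneLevelTop.HasTypeIConstant`, `snapLevel` = `SnapshotTop.snapLevel`, `exists_fast_at` = `SnapshotTop.exists_fast_at`, `sqrt_mul_sq_mul` = `SnapshotTop.sqrt_mul_sq_mul`, `CalmPocketsAt` = `SnapshotTop.CalmPocketsAt`, `Row_F1cs` = `SnapshotTop.Row_F1cs`, `HasPorousTopAt` = `SnapshotTop.HasPorousTopAt`, `IsSubcriticalLevel` = `SnapshotTop.IsSubcriticalLevel`, `HasPorousTop` = `SnapshotTop.HasPorousTop`, `Row_F1po` = `SnapshotTop.Row_F1po`, `eventually_calmPocketsAt_of_porous` = `SnapshotTop.eventually_calmPocketsAt_of_porous`, `rowF1po_of_rowF1cs` = `SnapshotTop.rowF1po_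of_rowF1cs`.
-/

-- the summit and its single problem share the name `NavierStokesRegularity` (D-0017 nested layout)
set_option linter.dupNamespace false

noncomputable section

open MeasureTheory Set Function Filter TopologicalSpace Metric
open scoped Topology NNReal ENNReal InnerProductSpace

namespace Summit.NavierStokesRegularity.NavierStokesRegularity.Theorems.ScenarioCensus.NeedleTop

open Literature.Analysis Literature.Analysis.FluidPDE
open Summit.NavierStokesRegularity.NavierStokesRegularity.Theorems
open Summit.NavierStokesRegularity.NavierStokesRegularity.Theses

/-! ## §6 Second cell on the same mechanism — RADIALLY CALM SECTORS: ONE COMPONENT on a cap of rays; kill (KN) with `L = ⟨·, e⟩`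

A needle constrains ALL THREE components of `u` on a set of dimension one.  The dual cell constrains ONE component on a set of
dimension three: around the fast point `x`, on a cap of directions `e` (‖e − e₀‖ ≤ η) and radii `r ∈ [r₀, r₀ + a]` (parabolic
units), only the component of `u(t, x + rℓe)` ALONG `e` — the RADIAL component seen from `x` — is `ε`-calm.  Fluid CIRCULATING
about the fast point at full Type-I speed satisfies it (for a rigid rotation about an axis through `x` the radial component
vanishes identically), so the identity theorem on the slice is useless here even though the sector has interior.  The kill is
again radial continuation into the centre, now with the read-out `L = ⟨·, e⟩`, ray by ray: `⟨W(−1, 0), e⟩ = 0` for every `e` in a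
cap, and a cap of directions spans `ℝ³`.  The two cells are NON-EQUIVALENT snapshot conditions (neither hypothesis implies the
other: a calm needle says nothing about radial components off its ray, a calm sector nothing about the swirl components on any
ray); both rows are proved by the same two-step mechanism (snapshot package + (KN)). -/

/-- **Radially calm sector at ONE instant `t`** (level `Λ`, reach `A`, length `a`, aperture `η`, threshold `ε`; `ℓ = √(ν(T − t))`):
every `Λ`-fast point `x` carries a unit direction `e₀` and a start `r₀ ∈ [0, A]` such that for every direction `e` with
`‖e − e₀‖ ≤ η` and every `r ∈ [r₀, r₀ + a]` the component along `e` of `u(t, x + rℓe)` has dimensionless size `≤ ε`. -/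
def RadialCalmSectorAt (ν T : ℝ) (u : ℝ → E3 → E3) (Λ A a η ε t : ℝ) : Prop :=
  ∀ x ∈ TwoTimeTop.topSet ν T u Λ t, ∃ e₀ : E3, ‖e₀‖ = 1 ∧ ∃ r₀ ∈ Icc (0 : ℝ) A, ∀ e ∈ closedBall e₀ η,
    ∀ r ∈ Icc r₀ (r₀ + a),
      Real.sqrt (T - t) * |⟪u t (x + (r * Real.sqrt (ν * (T - t))) • e), e⟫_ℝ| ≤ ε * Real.sqrt ν

/-- **ROW F1sc «RADIALLY-CALM-SECTOR SNAPSHOTS»** (Type I · no symmetry · Clay class; PROVED, `rowF1sc_holds`): for every `M`, reach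
`A`, length `a > 0` and aperture `η > 0` there is `ε = ε(M, A, a, η) > 0` such that radially calm sectors at every `c_S`-fast point
along SOME sequence of instants `t_k ↑ T` force smooth extension past `T`. -/
def Row_F1sc : Prop :=
  ∀ (M A a η : ℝ), 0 < a → 0 < η → ∃ ε : ℝ, 0 < ε ∧
    ∀ (ν T : ℝ), 0 < ν → 0 < T → ∀ (u : ℝ → E3 → E3) (p : ℝ → E3 → ℝ),
    IsClassicalNSSolutionOn (Ico 0 T) ν 0 u p → IsLerayHopfOn T ν 0 (u 0) u →
    HasRapidSpatialDecay (u 0) → OneLevelTop.HasTypeIConstant ν T M u →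
    (∃ᶠ t in 𝓝[<] T, RadialCalmSectorAt ν T u SnapshotTop.snapLevel A a η ε t) →
    HasSmoothExtensionPast ν 0 u T

/-- **Sectors pass to pointwise limits, shrunken** (compactness of `(e₀_j, r₀_j)`; a FIXED ray point `r e` with `e` in the
half-aperture cap about the limit direction and `r` in the middle half of the limit radial range lies in the `j`-th sector
eventually, so POINTWISE convergence suffices here). -/
theorem sector_limit {A a η : ℝ} (ha : 0 < a) (hη : 0 < η) {f : ℕ → E3 → E3} {g : E3 → E3}
    (hfg : ∀ y, Tendsto (fun j => f j y) atTop (𝓝 (g y)))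
    {e₀ : ℕ → E3} (he₀ : ∀ j, ‖e₀ j‖ = 1) {r₀ : ℕ → ℝ} (hr₀ : ∀ j, r₀ j ∈ Icc (0 : ℝ) A)
    {b : ℕ → ℝ} {b₀ : ℝ} (hb : Tendsto b atTop (𝓝 b₀))
    (hf : ∀ j, ∀ e ∈ closedBall (e₀ j) η, ∀ r ∈ Icc (r₀ j) (r₀ j + a), |⟪f j (r • e), e⟫_ℝ| ≤ b j) :
    ∃ e₁ : E3, ‖e₁‖ = 1 ∧ ∃ ρ₀ ∈ Icc (0 : ℝ) A, ∀ e ∈ closedBall e₁ (η / 2),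
      ∀ r ∈ Icc (ρ₀ + a / 4) (ρ₀ + 3 * a / 4), |⟪g (r • e), e⟫_ℝ| ≤ b₀ := by
  have hK : IsCompact (sphere (0 : E3) 1 ×ˢ Icc (0 : ℝ) A) := (isCompact_sphere _ _).prod isCompact_Icc
  have hmem : ∀ j, (fun j => (e₀ j, r₀ j)) j ∈ sphere (0 : E3) 1 ×ˢ Icc (0 : ℝ) A :=
    fun j => ⟨mem_sphere_zero_iff_norm.2 (he₀ j), hr₀ j⟩
  obtain ⟨q, hq, ψ, hψ, hlim⟩ := hK.tendsto_subseq hmem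
  obtain ⟨hq1, hq2⟩ := hq
  refine ⟨q.1, mem_sphere_zero_iff_norm.1 hq1, q.2, hq2, fun e he r hr => ?_⟩
  have hψt : Tendsto ψ atTop atTop := hψ.tendsto_atTop
  have hlim' := (Prod.tendsto_iff _ _).1 hlim
  have he_lim : Tendsto (fun j => e₀ (ψ j)) atTop (𝓝 q.1) := hlim'.1
  have hr_lim : Tendsto (fun j => r₀ (ψ j)) atTop (𝓝 q.2) := hlim'.2
  have hev₁ : ∀ᶠ j in atTop, dist (e₀ (ψ j)) q.1 < η / 2 := Metric.tendsto_nhds.1 he_lim _ (by positivity)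
  have hev₂ : ∀ᶠ j in atTop, dist (r₀ (ψ j)) q.2 < a / 4 := Metric.tendsto_nhds.1 hr_lim _ (by positivity)
  have h1 : Tendsto (fun j => |⟪f (ψ j) (r • e), e⟫_ℝ|) atTop (𝓝 |⟪g (r • e), e⟫_ℝ|) :=
    (((hfg (r • e)).comp hψt).inner tendsto_const_nhds).abs
  refine le_of_tendsto_of_tendsto h1 (hb.comp hψt) ?_
  filter_upwards [hev₁, hev₂] with j hj₁ hj₂
  apply hf (ψ j) e ?_ r ?_
  · rw [mem_closedBall] at he ⊢
    have h3 := dist_triangle e q.1 (e₀ (ψ j))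
    rw [dist_comm] at hj₁
    linarith
  · rw [Real.dist_eq] at hj₂
    have h3 := abs_lt.1 hj₂
    exact ⟨by linarith [hr.1, h3.1, h3.2], by linarith [hr.2, h3.1, h3.2]⟩

/-- The **sector defect below `Λ`** of `W` on the slice `s = −1` (reach `A`, middle radial half of length `a/2`, aperture `η/2`). -/
def SectorDefectBelow (A a η Λ : ℝ) (W : ℝ → E3 → E3) : Prop :=
  ∃ e₁ : E3, ‖e₁‖ = 1 ∧ ∃ ρ₀ ∈ Icc (0 : ℝ) A, ∀ e ∈ closedBall e₁ (η / 2),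
    ∀ r ∈ Icc (ρ₀ + a / 4) (ρ₀ + 3 * a / 4), |⟪W (-1) (r • e), e⟫_ℝ| ≤ Λ

/-- A vector orthogonal to a ball of directions is zero (a cap of directions spans `ℝ³`). -/
theorem eq_zero_of_inner_eq_zero_on_ball (w e₀ : E3) {δ : ℝ} (hδ : 0 < δ)
    (h : ∀ e ∈ closedBall e₀ δ, ⟪w, e⟫_ℝ = 0) : w = 0 := by
  by_contra hw
  have hnorm : 0 < ‖w‖ := norm_pos_iff.2 hw
  have h0 := h e₀ (mem_closedBall_self hδ.le)
  have hmem : e₀ + (δ / ‖w‖) • w ∈ closedBall e₀ δ := by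
    rw [mem_closedBall, dist_eq_norm, add_sub_cancel_left, norm_smul, Real.norm_eq_abs,
      abs_of_pos (div_pos hδ hnorm), div_mul_cancel₀ δ hnorm.ne']
  have h1 := h _ hmem
  rw [inner_add_right, h0, zero_add, real_inner_smul_right, real_inner_self_eq_norm_sq] at h1
  have h2 : 0 < δ / ‖w‖ * ‖w‖ ^ 2 := by positivity
  linarith

/-- **THE SECTOR LEVEL `Λ₁(M, A, a, η, κ)`**: no `W ∈ 𝒦_M` with `‖W(−1, 0)‖ ≥ κ` has sector defect below `Λ₁` (socket + sector
limit + (KN) ray by ray with `L = ⟨·, e⟩` + spanning). -/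
theorem exists_sectorLevel (M A a η : ℝ) (ha : 0 < a) (hη : 0 < η) {κ : ℝ} (hκ : 0 < κ) :
    ∃ Λ₁ : ℝ, 0 < Λ₁ ∧ ∀ W : ℝ → E3 → E3, IsTypeIAncientMild M W → κ ≤ ‖W (-1) 0‖ →
      ¬ SectorDefectBelow A a η Λ₁ W := by
  refine exists_level_of_limitKill M hκ (SectorDefectBelow A a η) ?_
  intro Wn W ε hεpos hεlim hWn hW hP hpt _ _
  choose e₁ he₁ ρ₀ hρ₀ hcalm using hP
  -- the defects are sectors of aperture `η/2`, start `ρ₀_n + a/4 ∈ [0, A + a/4]`, length `a/2`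
  have hr₀' : ∀ n, ρ₀ n + a / 4 ∈ Icc (0 : ℝ) (A + a / 4) := fun n =>
    ⟨by linarith [(hρ₀ n).1], by linarith [(hρ₀ n).2]⟩
  have hcalm' : ∀ n, ∀ e ∈ closedBall (e₁ n) (η / 2), ∀ r ∈ Icc (ρ₀ n + a / 4) (ρ₀ n + a / 4 + a / 2),
      |⟪Wn n (-1) (r • e), e⟫_ℝ| ≤ ε n := by
    intro n e he r hr
    exact hcalm n e he r ⟨hr.1, by linarith [hr.2]⟩
  obtain ⟨e₂, -, ρ₁, -, hlim⟩ := sector_limit (A := A + a / 4) (by positivity : 0 < a / 2) (by positivity : 0 < η / 2)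
    (fun y => hpt (-1) (by norm_num) y) he₁ hr₀' hεlim hcalm'
  -- every direction of the limit cap is orthogonal to `W(−1, 0)`: (KN) along the ray with `L = ⟨·, e⟩`
  have horth : ∀ e ∈ closedBall e₂ (η / 2 / 2), ⟪W (-1) 0, e⟫_ℝ = 0 := by
    intro e he
    have hzero : ∀ r ∈ Ioo (ρ₁ + a / 2 / 4) (ρ₁ + 3 * (a / 2) / 4), (innerSL ℝ e) (W (-1) (r • e)) = 0 := by
      intro r hr
      have h0 : |⟪W (-1) (r • e), e⟫_ℝ| ≤ 0 := hlim e he r ⟨hr.1.le, hr.2.le⟩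
      rw [innerSL_apply_apply, real_inner_comm]
      exact abs_nonpos_iff.1 h0
    have h1 := needle_kill hW (by norm_num) (innerSL ℝ e) e (by linarith) hzero
    rwa [innerSL_apply_apply, real_inner_comm] at h1
  exact eq_zero_of_inner_eq_zero_on_ball (W (-1) 0) e₂ (by positivity) horth

/-- **ROW F1sc holds** (snapshot package of §3, pointwise values + sector level). -/
theorem rowF1sc_holds : Row_F1sc := by
  intro M A a η ha hη
  obtain ⟨Λ₁, hΛ₁, hlev⟩ := exists_sectorLevel M A a η ha hη SnapshotTop.snapLevel_pos
  refine ⟨Λ₁, hΛ₁, ?_⟩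
  intro ν T hν hT u p hsol hLH hdec hM hfreq
  by_contra hmax
  obtain ⟨c, x, W, hcpos, -, hW, hQ, hxfast, hconv, -, -, hnorm⟩ :=
    exists_snapshotZoom_package hν hT hsol hLH hdec hM hmax hfreq
  apply hlev W hW hnorm
  have hpk : ∀ j, ∃ e₀ : E3, ‖e₀‖ = 1 ∧ ∃ r₀ ∈ Icc (0 : ℝ) A, ∀ e ∈ closedBall e₀ η, ∀ r ∈ Icc r₀ (r₀ + a),
      |⟪(c j * 1) • u (T + c j ^ 2 * ν * (-1)) (x j + (c j * ν) • (r • e)), e⟫_ℝ| ≤ Λ₁ := by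
    intro j
    obtain ⟨hunit, hsq⟩ := zoom_units (T := T) hν hcpos j
    obtain ⟨e₀, he₀, r₀, hr₀, hcalm⟩ := hQ j (x j) (hxfast j)
    refine ⟨e₀, he₀, r₀, hr₀, fun e he r hr => ?_⟩
    have h1 := hcalm e he r hr
    rw [hunit, hsq] at h1
    have e1 : x j + (c j * ν) • (r • e) = x j + (r * (c j * ν)) • e := by rw [smul_smul, mul_comm]
    rw [e1, real_inner_smul_left, abs_mul, abs_of_pos (mul_pos (hcpos j) one_pos), mul_one]
    set q : ℝ := |⟪u (T + c j ^ 2 * ν * (-1)) (x j + (r * (c j * ν)) • e), e⟫_ℝ| with hq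
    have h2 : c j * q * Real.sqrt ν ≤ Λ₁ * Real.sqrt ν := by
      linarith [h1, mul_comm (Real.sqrt ν) q, mul_assoc (c j) (Real.sqrt ν) q]
    exact le_of_mul_le_mul_right h2 (Real.sqrt_pos.2 hν)
  choose e₀ he₀ r₀ hr₀ hcalm using hpk
  obtain ⟨e₁, he₁, ρ₀, hρ₀, hlim⟩ := sector_limit ha hη (fun y => hconv (-1) (by norm_num) y) he₀ hr₀
    (tendsto_const_nhds (x := Λ₁)) hcalm
  exact ⟨e₁, he₁, ρ₀, hρ₀, hlim⟩

/-- **The definite sector threshold `ε(M, A, a, η)`** (a choice; `1` outside `a, η > 0`).  Ineffective. -/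
def sectorLevel (M A a η : ℝ) : ℝ :=
  if h : 0 < a ∧ 0 < η then Classical.choose (rowF1sc_holds M A a η h.1 h.2) else 1

/-- The definite calm-sector threshold is positive. -/
theorem sectorLevel_pos (M A a η : ℝ) : 0 < sectorLevel M A a η := by
  unfold sectorLevel
  split_ifs with h
  · exact (Classical.choose_spec (rowF1sc_holds M A a η h.1 h.2)).1
  · exact one_pos

/-- **Row F1sc at the named threshold.** -/
theorem sectorLevel_spec {a η : ℝ} (M A : ℝ) (ha : 0 < a) (hη : 0 < η) :
    ∀ (ν T : ℝ), 0 < ν → 0 < T → ∀ (u : ℝ → E3 → E3) (p : ℝ → E3 → ℝ),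
    IsClassicalNSSolutionOn (Ico 0 T) ν 0 u p → IsLerayHopfOn T ν 0 (u 0) u →
    HasRapidSpatialDecay (u 0) → OneLevelTop.HasTypeIConstant ν T M u →
    (∃ᶠ t in 𝓝[<] T, RadialCalmSectorAt ν T u SnapshotTop.snapLevel A a η (sectorLevel M A a η) t) →
    HasSmoothExtensionPast ν 0 u T := by
  have e : sectorLevel M A a η = Classical.choose (rowF1sc_holds M A a η ha hη) := by
    unfold sectorLevel; rw [dif_pos ⟨ha, hη⟩]
  rw [e]
  exact (Classical.choose_spec (rowF1sc_holds M A a η ha hη)).2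

/-- Reading of the negated sector condition: some `Λ`-fast point `x` such that for EVERY unit direction `e₀` and start
`r₀ ∈ [0, A]` some ray point `x + rℓe` with `‖e − e₀‖ ≤ η`, `r ∈ [r₀, r₀ + a]` has RADIAL component of dimensionless size `> ε`. -/
theorem not_radialCalmSectorAt_iff {ν T : ℝ} {u : ℝ → E3 → E3} {Λ A a η ε t : ℝ} :
    ¬ RadialCalmSectorAt ν T u Λ A a η ε t ↔ ∃ x ∈ TwoTimeTop.topSet ν T u Λ t, ∀ e₀ : E3, ‖e₀‖ = 1 → ∀ r₀ ∈ Icc (0 : ℝ) A,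
      ∃ e ∈ closedBall e₀ η, ∃ r ∈ Icc r₀ (r₀ + a),
        ε * Real.sqrt ν < Real.sqrt (T - t) * |⟪u t (x + (r * Real.sqrt (ν * (T - t))) • e), e⟫_ℝ| := by
  unfold RadialCalmSectorAt
  push Not
  rfl

/-- **THE SWIRL FLOOR** (structural, maximal frame, EVERY late instant): at a maximal Type-I Clay blow-up with constant `M`, for
all `A`, `a > 0`, `η > 0`, at EVERY instant close to `T` some `c_S`-fast point has, in EVERY sector of aperture `η` and radial
range `[r₀, r₀ + a]ℓ` (`r₀ ≤ A`) about it, a ray point whose RADIAL velocity component (towards/away from the fast point) has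
dimensionless size `> ε(M, A, a, η)` — the flow about a fast point is never, in any sector at the critical scale, a pure
circulation about it.  PROVED. -/
def SwirlFloor : Prop :=
  ∀ (ν T : ℝ), 0 < ν → 0 < T → ∀ (u : ℝ → E3 → E3) (p : ℝ → E3 → ℝ),
    IsMaximalSmoothSolution ν 0 u p T → IsLerayHopfOn T ν 0 (u 0) u → HasRapidSpatialDecay (u 0) →
    ∀ M A a η : ℝ, OneLevelTop.HasTypeIConstant ν T M u → 0 < a → 0 < η →
      ∀ᶠ t in 𝓝[<] T, ¬ RadialCalmSectorAt ν T u SnapshotTop.snapLevel A a η (sectorLevel M A a η) t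

/-- **The SWIRL floor holds.** -/
theorem swirlFloor_holds : SwirlFloor := by
  intro ν T hν hT u p hmax hLH hdec M A a η hM ha hη
  by_contra hno
  rw [Filter.not_eventually] at hno
  apply hmax.2 (sectorLevel_spec M A ha hη ν T hν hT u p hmax.1 hLH hdec hM ?_)
  exact hno.mono fun t ht => not_not.1 ht

/-! ## §7 Summary -/

/-- **LINE «needle-top», summary.**  Rows `Row_F1nd` (calm radial needles on snapshots) and `Row_F1sc` (radially calm sectors on
snapshots) — PROVED; floors `HedgehogFloor`, `SwirlFloor` (every late instant, maximal frame) — PROVED; residual `NeedleCollapse`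
≡ row F1 — DECLARED, not claimed; order `Row_F1nd ⟹ SnapshotTop.Row_F1cs ⟹ SnapshotTop.Row_F1po` in kernel.  No summit is proved; `Row_F1` stays OPEN. -/
theorem needleTop_summary :
    Row_F1nd ∧ Row_F1sc ∧ HedgehogFloor ∧ SwirlFloor ∧ (NeedleCollapse ↔ ScenarioCensus.Row_F1) ∧ SnapshotTop.Row_F1cs ∧ SnapshotTop.Row_F1po :=
  ⟨rowF1nd_holds, rowF1sc_holds, hedgehogFloor_holds, swirlFloor_holds, needleCollapse_iff_rowF1, rowF1cs_of_rowF1nd rowF1nd_holds,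
    rowF1po_of_rowF1nd rowF1nd_holds⟩

end Summit.NavierStokesRegularity.NavierStokesRegularity.Theorems.ScenarioCensus.NeedleTop

namespace Summit.NavierStokesRegularity.NavierStokesRegularity.Theorems.ScenarioCensus

/-! ## Census KEYS (ns `…Theorems.ScenarioCensus`): the NEEDLE members of row F1 (LINE 37) — TREE-decided F1nd / F1ne / F1sc and floors HF / SWF -/

/-- **Cell F1nd** (CALM-NEEDLE SNAPSHOTS: Type I with constant `M` · along some `t_k ↑ T` every `c_S`-fast point carries an `ε(M, A, a)`-calm radial needle of length `aℓ` starting within `Aℓ` ⇒ smooth extension past `T`): `:= NeedleTop.Row_F1nd`. DECIDED. -/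
def Row_F1nd : Prop := NeedleTop.Row_F1nd
/-- F1nd is EXCLUDED (decided in the tree): `NeedleTop.rowF1nd_holds`. -/
theorem row_F1nd_excluded : Row_F1nd := NeedleTop.rowF1nd_holds

/-- **Cell F1ne** (eventual form of the calm-needle criterion): `:= NeedleTop.Row_F1ne`. DECIDED. -/
def Row_F1ne : Prop := NeedleTop.Row_F1ne
/-- F1ne is EXCLUDED (decided in the tree): `NeedleTop.rowF1ne_holds`. -/
theorem row_F1ne_excluded : Row_F1ne := NeedleTop.rowF1ne_holds

/-- **Cell F1sc** (RADIALLY CALM SECTORS: one component `⟪u, e⟫` calm on a cap of rays about a fast point, at snapshots ⇒ extension; distinct from «caged-top»'s F1scg): `:= NeedleTop.Row_F1sc`. DECIDED. -/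
def Row_F1sc : Prop := NeedleTop.Row_F1sc
/-- F1sc is EXCLUDED (decided in the tree): `NeedleTop.rowF1sc_holds`. -/
theorem row_F1sc_excluded : Row_F1sc := NeedleTop.rowF1sc_holds

/-- **Floor HF — the HEDGEHOG floor** (every late instant, maximal frame): `NeedleTop.hedgehogFloor_holds`. -/
theorem row_F1_hedgehogFloor : NeedleTop.HedgehogFloor := NeedleTop.hedgehogFloor_holds
/-- **Floor SWF — the SWIRL floor**: `NeedleTop.swirlFloor_holds`. -/
theorem row_F1_swirlFloor : NeedleTop.SwirlFloor := NeedleTop.swirlFloor_holds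
/-- Order edges at key level: F1nd ⇒ F1ne, F1nd ⇒ F1cs ⇒ F1po (`NeedleTop.rowF1ne_of_rowF1nd` / `rowF1cs_of_rowF1nd` / `rowF1po_of_rowF1nd`). -/
theorem rowF1ne_of_rowF1nd : Row_F1nd → Row_F1ne := NeedleTop.rowF1ne_of_rowF1nd
/-- See `rowF1ne_of_rowF1nd`. -/
theorem rowF1cs_of_rowF1nd : Row_F1nd → Row_F1cs := NeedleTop.rowF1cs_of_rowF1nd
/-- See `rowF1ne_of_rowF1nd`. -/
theorem rowF1po_of_rowF1nd : Row_F1nd → Row_F1po := NeedleTop.rowF1po_of_rowF1nd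

end Summit.NavierStokesRegularity.NavierStokesRegularity.Theorems.ScenarioCensus

end
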